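import Summits.AtomisticToContinuum.Crystallization.Theorems.FluxTubeKeplerFloorGivesLayered
import Summits.AtomisticToContinuum.Crystallization.Theorems.FluxTubeKeplerFluxCellKeplerSingleScale
import Summits.AtomisticToContinuum.Crystallization.Theorems.ChessboardParticlePlanesPeriodicWindowsIffCrystallization

/-!
# `DecayingMarginRung` — F4 on-path certificate (no `sorry`): `Crystallization → DecayingMarginRung`

Forward rung over `FluxTubeKepler.FloorGivesLayered` (crux dir `FluxCellKepler`, stmt-AtomisticToContinuum-15221;
fwd-rung G1 gen 10).  Re-declares the family of `Lines/DecayingMarginRung.lean` in namespace `…MarginLadder.OnPath` and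
proves that the sub-problem implies every member of the dial (`marginRung_of_crystallization`, via the landed
`ChessboardParticlePlanesPeriodicWindowsIffCrystallization.periodicWindows_of_crystallization`), in particular the
deciding rung (`DecayingMarginRung_of_Crystallization`, `@[aesop safe apply]`).
-/

noncomputable section

namespace Summit.AtomisticToContinuum.Crystallization.Cruxes.FluxCellKepler.MarginLadder.OnPath

open Filter Topology
open Literature.MathematicalPhysics.StatisticalMechanics
open Summit.AtomisticToContinuum.Crystallization.Theorems.FluxCellKeplerSingleScale (LayeredGood)

local notation "E3" => EuclideanSpace ℝ (Fin 3)

/-- FLOOR(P₀) (verbatim). -/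
def Floor (P₀ : PeriodicConfiguration 3) : Prop :=
  ∀ (N : ℕ) (x : Fin N → E3), IsGroundState lennardJones x →
    (N : ℝ) * P₀.energyPerParticle lennardJones ≤ interactionEnergy lennardJones x

/-- MARGIN BUDGET with exponent `s` (verbatim). -/
def MarginBudget (s : ℝ) (P₀ : PeriodicConfiguration 3) : Prop :=
  ∀ R η : ℝ, 0 < R → 0 < η → ∃ c : ℝ, 0 < c ∧
    ∀ (N : ℕ) (x : Fin N → E3), IsGroundState lennardJones x →
      c * (Nat.card {i : Fin N // ¬ LayeredGood R η x i} : ℝ) ≤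
        (N : ℝ) ^ s * (interactionEnergy lennardJones x - (N : ℝ) * P₀.energyPerParticle lennardJones)

/-- Periodic windows along the sequence (verbatim). -/
def HasPeriodicWindows (x : (N : ℕ) → (Fin N → E3)) : Prop :=
  ∃ P : PeriodicConfiguration 3, ∀ R ε : ℝ, 0 < ε → ∃ᶠ N in atTop, ∃ t : E3,
    (∀ q ∈ P.points, ‖q‖ ≤ R → ∃ i : Fin N, dist (x N i + t) q ≤ ε) ∧
    (∀ i : Fin N, ‖x N i + t‖ ≤ R → ∃ q ∈ P.points, dist (x N i + t) q ≤ ε)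

/-- The graded family (verbatim). -/
def MarginRung (s : ℝ) : Prop :=
  ∀ P₀ : PeriodicConfiguration 3, Floor P₀ → MarginBudget s P₀ →
    ∀ x : (N : ℕ) → (Fin N → E3), (∀ N, IsGroundState lennardJones (x N)) → HasPeriodicWindows x

/-- The deciding rung (verbatim). -/
def DecayingMarginRung : Prop := ∀ s : ℝ, s < 1 / 3 → MarginRung s

/-- ON-PATH: `Crystallization → MarginRung s` for every exponent. -/
theorem marginRung_of_crystallization (s : ℝ) (h : _root_.Crystallization) : MarginRung s :=
  fun _ _ _ x hx =>
    Theorems.ChessboardParticlePlanesPeriodicWindowsIffCrystallization.periodicWindows_of_crystallization h x hx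

/-- ON-PATH for the deciding rung. -/
@[aesop safe apply]
theorem DecayingMarginRung_of_Crystallization (h : _root_.Crystallization) : DecayingMarginRung :=
  fun s _ => marginRung_of_crystallization s h

/-- The on-path lemma in `example` form. -/
example : _root_.Crystallization → DecayingMarginRung := DecayingMarginRung_of_Crystallization

end Summit.AtomisticToContinuum.Crystallization.Cruxes.FluxCellKepler.MarginLadder.OnPath

end
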